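import Summits.Ventures.PercRepro.S1CoreCapThirtyTwo

/-!
# PercRepro — THE `s₄` BASE AT NULLITY `4`, THE EASY PART: `s₄ ≤ 16` once there are `≥ 10` non-coloops (p2, gen 20;
SUBCLAIM-S1 §6.0 v44 — the planner target)

The kernel table gives `s₄ ≤ capKer 4 = 18` on every core of nullity `4`; the true maximum is `13` (the engine's
complete catalogue on `≤ 9` points). The averaging recursion (S1CoreCapThirtyTwo) with `m ≥ 10` non-coloops on
`s₄ ≤ capKer 3 = 10` at nullity `3` gives `s₄ − ⌊4·s₄/10⌋ ≤ 10`, i.e. `s₄ ≤ 16`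
(`ncard_fourCircuits_le_sixteen_of_ten`). So the nullity-`4` structure theorem `s₄ ≤ 13` reduces to the cores with
`8` or `9` non-coloops — the `8`-point rank-`4` and the `9`-point rank-`5` configurations
(`ncard_fourCircuits_le_sixteen_or_nonColoops_le_nine`; the non-coloops number `≥ 8`: S1FiveCircuitBase's `nonColoops_nullity_four`); with `9` the recursion (`m = 9`) gives only `18`.
Axioms: standard.
-/

open scoped Matroid

namespace PercRepro

namespace S1

open Set

open FourCap

variable {α : Type}

/-- **`s₄ ≤ 16` on a core of nullity `4` with at least `10` non-coloops**: the averaging recursion with `m = 10`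
on `capKer 3 = 10`. -/
theorem ncard_fourCircuits_le_sixteen_of_ten (M : Matroid α) [M.Finite]
    (hfree : ∀ e ∈ M.E, ∃ A ⊆ M.E \ {e}, e ∉ M.closure A ∧ e ∉ M.closure ((M.E \ {e}) \ A))
    (hd : M.E.encard = M.eRank + 4) (h10 : 10 ≤ (M.E \ M.coloops).ncard) :
    {C : Set α | M.IsCircuit C ∧ C.ncard = 4}.ncard ≤ 16 := by
  have hd' : M.E.encard = M.eRank + ((3 : ℕ) + 1) := by rw [hd]; norm_num
  have h10' : capKer 3 = 10 := by decide
  have h := ncard_fourCircuits_sub_div_le_of_nonColoops M hfree hd' (by norm_num) h10 (B := 10)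
    (fun M' _ hfree' hd3 => by
      have h := ncard_fourCircuits_le_capKer M' hfree' (d := 3) hd3
      omega)
  omega

/-- **The reduction**: on a core of nullity `4`, either the non-coloops number `8` or `9` (the two finite
configurations of the structure theorem) or `s₄ ≤ 16`. -/
theorem ncard_fourCircuits_le_sixteen_or_nonColoops_le_nine (M : Matroid α) [M.Finite]
    (hfree : ∀ e ∈ M.E, ∃ A ⊆ M.E \ {e}, e ∉ M.closure A ∧ e ∉ M.closure ((M.E \ {e}) \ A))
    (hd : M.E.encard = M.eRank + 4) :
    (M.E \ M.coloops).ncard ≤ 9 ∨ {C : Set α | M.IsCircuit C ∧ C.ncard = 4}.ncard ≤ 16 := by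
  rcases Nat.lt_or_ge (M.E \ M.coloops).ncard 10 with h | h
  · exact Or.inl (by omega)
  · exact Or.inr (ncard_fourCircuits_le_sixteen_of_ten M hfree hd h)

/-- **How the base propagates (conditional scaffold)**: if every core of nullity `4` has `s₄ ≤ B`, then a core of
nullity `5` with at least `10` non-coloops has `s₄ ≤ ⌊10·B/6⌋` — with the true base `B = 13` that is `21`, the
census maximum at nullity `5` and what the cell `(11, 5)` needs together with the cobasis lever (S1 v44 §6.0). -/
theorem ncard_fourCircuits_le_of_ten_of_base (M : Matroid α) [M.Finite]
    (hfree : ∀ e ∈ M.E, ∃ A ⊆ M.E \ {e}, e ∉ M.closure A ∧ e ∉ M.closure ((M.E \ {e}) \ A))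
    (hd : M.E.encard = M.eRank + 5) (h10 : 10 ≤ (M.E \ M.coloops).ncard) {B : ℕ}
    (hB : ∀ (M' : Matroid α) [M'.Finite],
      (∀ e ∈ M'.E, ∃ A ⊆ M'.E \ {e}, e ∉ M'.closure A ∧ e ∉ M'.closure ((M'.E \ {e}) \ A)) →
      M'.E.encard = M'.eRank + 4 → {C : Set α | M'.IsCircuit C ∧ C.ncard = 4}.ncard ≤ B) :
    {C : Set α | M.IsCircuit C ∧ C.ncard = 4}.ncard ≤ 10 * B / 6 := by
  have hd' : M.E.encard = M.eRank + ((4 : ℕ) + 1) := by rw [hd]; norm_num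
  have h := ncard_fourCircuits_sub_div_le_of_nonColoops M hfree hd' (by norm_num) h10 (B := B)
    (fun M' _ hfree' hd4 => hB M' hfree' (by exact_mod_cast hd4))
  exact le_mul_div_of_sub_div_le (m := 10) (by norm_num) h

/-- With the true base `13`: `s₄ ≤ 21` at nullity `5` on the cores with `≥ 10` non-coloops. -/
theorem ncard_fourCircuits_le_twenty_one_of_ten_of_base_thirteen (M : Matroid α) [M.Finite]
    (hfree : ∀ e ∈ M.E, ∃ A ⊆ M.E \ {e}, e ∉ M.closure A ∧ e ∉ M.closure ((M.E \ {e}) \ A))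
    (hd : M.E.encard = M.eRank + 5) (h10 : 10 ≤ (M.E \ M.coloops).ncard)
    (hB : ∀ (M' : Matroid α) [M'.Finite],
      (∀ e ∈ M'.E, ∃ A ⊆ M'.E \ {e}, e ∉ M'.closure A ∧ e ∉ M'.closure ((M'.E \ {e}) \ A)) →
      M'.E.encard = M'.eRank + 4 → {C : Set α | M'.IsCircuit C ∧ C.ncard = 4}.ncard ≤ 13) :
    {C : Set α | M.IsCircuit C ∧ C.ncard = 4}.ncard ≤ 21 :=
  ncard_fourCircuits_le_of_ten_of_base M hfree hd h10 hB

end S1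

end PercRepro
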